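import Literature.NumberTheory.GaloisRepresentations.HasseArfCyclic
import Mathlib.Algebra.Polynomial.Eval.Irreducible
import Mathlib.Algebra.Polynomial.SpecificDegree
import HarnessLib

/-!
# Hasse–Arf: base change of a Galois extension along a quadratic extension (field theory)

Auxiliary field theory for the residue-field enlargement in the proof of the Hasse–Arf theorem
(`HasseArfCyclic`: Serre's argument for Prop. V.11 needs a residue field which is not the
prime field; Serre, *Local Fields*, Ch. V §4 Lemma 7 / §7 enlarges the residue field by an
unramified extension).  Given a finite Galois extension `L/K` and a monic separable quadratic
`f ∈ K[X]` which stays irreducible over `L`, let `L_f = L[X]/(f)` (`AdjoinRoot`), `α` the class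
of `X`, and `K_f = K(α) ⊆ L_f`.  We prove: `[L_f : L] = 2`, `L_f/K` is Galois
(`isGalois_adjoinRoot`), hence `L_f/K_f` is Galois, and restriction to `L` is a bijection
`Gal(L_f/K_f) ≃ Gal(L/K)` compatible with the inclusion `L ⊆ L_f`
(`restrictQuadratic_bijective`, `algebraMap_restrictQuadratic`).  The arithmetic of this base
change (primes, ramification) is in `HasseArfResidueExt`.

## References

* J.-P. Serre, *Local Fields*, GTM 67, Springer 1979, Ch. V §4 (Lemmas 6–7) and §7, p. 94
  ("we have taken the precaution of insuring that the residue field is not the prime field").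
  [SerreLocalFields1979]
* N. Bourbaki, *Algèbre*, Ch. V §10 (linearly disjoint extensions, translation theorem of
  Galois theory). [folklore]
-/

open Polynomial

noncomputable section

namespace Literature.NumberTheory.GaloisRepresentations

section QuadraticExt

variable (K L : Type*) [Field K] [Field L] [Algebra K L] (f : K[X])

/-- Elements of `F[X]/(g)`, `g` monic of degree `2`, are `a + b α`. [folklore] -/
theorem AdjoinRoot.exists_eq_add_mul_root {F : Type*} [Field F] {g : F[X]} (hg : g.Monic)
    (hg2 : g.natDegree = 2) (x : AdjoinRoot g) :
    ∃ a b : F, x = algebraMap F (AdjoinRoot g) a + algebraMap F (AdjoinRoot g) b * AdjoinRoot.root g := by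
  induction x using AdjoinRoot.induction_on with
  | ih p =>
    have hmod : AdjoinRoot.mk g p = AdjoinRoot.mk g (p %ₘ g) :=
      AdjoinRoot.mk_eq_mk.mpr ⟨p /ₘ g, by
        have := Polynomial.modByMonic_add_div p g
        linear_combination (-1 : F[X]) * this⟩
    have hg1 : g ≠ 1 := fun h => by rw [h, natDegree_one] at hg2; exact absurd hg2 (by norm_num)
    have hdeg : (p %ₘ g).degree ≤ 1 := by
      have := Polynomial.natDegree_modByMonic_lt p hg hg1
      rw [hg2] at this
      exact Polynomial.degree_le_of_natDegree_le (Nat.le_of_lt_succ this)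
    refine ⟨(p %ₘ g).coeff 0, (p %ₘ g).coeff 1, ?_⟩
    have hq := Polynomial.eq_X_add_C_of_degree_le_one hdeg
    calc AdjoinRoot.mk g p = AdjoinRoot.mk g (p %ₘ g) := hmod
      _ = AdjoinRoot.mk g (C ((p %ₘ g).coeff 1) * X + C ((p %ₘ g).coeff 0)) :=
          congrArg (AdjoinRoot.mk g) hq
      _ = _ := by
          rw [map_add, map_mul, AdjoinRoot.mk_C, AdjoinRoot.mk_C, AdjoinRoot.mk_X,
            AdjoinRoot.algebraMap_eq, add_comm]

/-- `[L[X]/(f) : L] = deg f`. [folklore] -/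
theorem finrank_adjoinRoot_map (hf : f.Monic) [Fact (Irreducible (f.map (algebraMap K L)))] :
    Module.finrank L (AdjoinRoot (f.map (algebraMap K L))) = f.natDegree := by
  have h0 : f.map (algebraMap K L) ≠ 0 := (hf.map _).ne_zero
  rw [(AdjoinRoot.powerBasis h0).finrank, AdjoinRoot.powerBasis_dim, Polynomial.natDegree_map]

/-- `L[X]/(f)` is finite over `K`. [folklore] -/
theorem finiteDimensional_adjoinRoot_map [FiniteDimensional K L] (hf : f.Monic)
    [Fact (Irreducible (f.map (algebraMap K L)))] :
    FiniteDimensional K (AdjoinRoot (f.map (algebraMap K L))) := by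
  have h0 : f.map (algebraMap K L) ≠ 0 := (hf.map _).ne_zero
  haveI : FiniteDimensional L (AdjoinRoot (f.map (algebraMap K L))) :=
    (AdjoinRoot.powerBasis h0).finite
  exact Module.Finite.trans L _

/-- A monic polynomial irreducible over an extension is irreducible over the base. [folklore] -/
theorem irreducible_of_irreducible_map (hf : f.Monic) (h : Irreducible (f.map (algebraMap K L))) :
    Irreducible f :=
  Polynomial.Monic.irreducible_of_irreducible_map (algebraMap K L) f hf h

/-- `minpoly K α = f` for the root `α` of the monic `f`, irreducible over `L`, in `L[X]/(f)`.
[folklore] -/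
theorem minpoly_root_eq (hf : f.Monic) [hirr : Fact (Irreducible (f.map (algebraMap K L)))] :
    minpoly K (AdjoinRoot.root (f.map (algebraMap K L))) = f := by
  symm
  refine minpoly.eq_of_irreducible_of_monic (irreducible_of_irreducible_map K L f hf hirr.out) ?_ hf
  have h := AdjoinRoot.eval₂_root (f.map (algebraMap K L))
  rw [Polynomial.eval₂_map] at h
  rw [Polynomial.aeval_def, IsScalarTower.algebraMap_eq K L (AdjoinRoot (f.map (algebraMap K L))),
    AdjoinRoot.algebraMap_eq]
  exact h

/-- `L[X]/(f)` is separable over `L` when `f` is separable. [folklore] -/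
theorem isSeparable_adjoinRoot_map (hf : f.Monic) (hsep : f.Separable)
    [hirr : Fact (Irreducible (f.map (algebraMap K L)))] :
    Algebra.IsSeparable L (AdjoinRoot (f.map (algebraMap K L))) := by
  have h0 : f.map (algebraMap K L) ≠ 0 := (hf.map _).ne_zero
  set α := AdjoinRoot.root (f.map (algebraMap K L)) with hα
  have hαsep : IsSeparable L α := by
    rw [IsSeparable, AdjoinRoot.minpoly_root h0, (hf.map _).leadingCoeff, inv_one, map_one, mul_one]
    exact hsep.map
  haveI : Algebra.IsSeparable L (IntermediateField.adjoin L {α}) :=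
    (IntermediateField.isSeparable_adjoin_simple_iff_isSeparable L _).mpr hαsep
  have htop : IntermediateField.adjoin L {α} = ⊤ := by
    refine eq_top_iff.mpr fun x _ => IntermediateField.algebra_adjoin_le_adjoin L _ ?_
    rw [hα, AdjoinRoot.adjoinRoot_eq_top]
    trivial
  exact Algebra.IsSeparable.of_algHom L (IntermediateField.adjoin L {α})
    ((IntermediateField.equivOfEq htop.symm).toAlgHom.comp
      (IntermediateField.topEquiv (F := L) (E := AdjoinRoot (f.map (algebraMap K L)))).symm.toAlgHom)

end QuadraticExt

/-! ### `L[X]/(f)` is Galois over `K` -/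

section Galois

variable (K L : Type*) [Field K] [Field L] [Algebra K L] (f : K[X])
  [FiniteDimensional K L] [IsGalois K L]

set_option maxHeartbeats 800000 in
/-- **`L_f = L[X]/(f)` is Galois over `K`** for `L/K` finite Galois and `f ∈ K[X]` a monic separable
quadratic which is irreducible over `L`: `L_f` is the splitting field over `K` of the separable
polynomial `P f`, `P` the minimal polynomial of a primitive element of `L/K` (both roots of the
quadratic `f` lie in `L_f` once one does).  Ref: Bourbaki, *Algèbre* V §10 (compositum of Galois
extensions). [folklore] -/
theorem isGalois_adjoinRoot_map (hf : f.Monic) (hf2 : f.natDegree = 2) (hsep : f.Separable)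
    [hirr : Fact (Irreducible (f.map (algebraMap K L)))] :
    IsGalois K (AdjoinRoot (f.map (algebraMap K L))) := by
  set fL := f.map (algebraMap K L) with hfL
  set E := AdjoinRoot fL
  have h0 : fL ≠ 0 := (hf.map _).ne_zero
  set α : E := AdjoinRoot.root fL with hα
  obtain ⟨θ, hθ⟩ := Field.exists_primitive_element K L
  set P := minpoly K θ with hP
  have hθint : IsIntegral K θ := IsIntegral.of_finite K θ
  have hPsep : P.Separable := Algebra.IsSeparable.isSeparable K θ
  have hPsplit : (P.map (algebraMap K L)).Splits := Normal.splits (inferInstance : Normal K L) θ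
  have hfirr : Irreducible f := irreducible_of_irreducible_map K L f hf hirr.out
  -- `f ∤ P` (else `f` would have a root in `L`)
  have hcop : IsCoprime P f := by
    refine (hfirr.coprime_iff_not_dvd.mpr fun hdvd => ?_).symm
    have hsplitf : fL.Splits :=
      Polynomial.Splits.of_dvd hPsplit (Polynomial.map_ne_zero (minpoly.ne_zero hθint))
        (Polynomial.map_dvd _ hdvd)
    have h1 := hsplitf.natDegree_le_one_of_irreducible hirr.out
    rw [hfL, Polynomial.natDegree_map, hf2] at h1
    exact absurd h1 (by norm_num)
  have hsepPf : (P * f).Separable := hPsep.mul hsep hcop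
  -- `P f` splits in `E`
  have hfα : (f.map (algebraMap K E)).IsRoot α := by
    rw [Polynomial.IsRoot, Polynomial.eval_map, ← Polynomial.aeval_def,
      ← minpoly_root_eq K L f hf, hα]
    exact minpoly.aeval K _
  have hsplits : ((P * f).map (algebraMap K E)).Splits := by
    rw [Polynomial.map_mul]
    refine Polynomial.Splits.mul ?_ ?_
    · rw [IsScalarTower.algebraMap_eq K L E, ← Polynomial.map_map]
      exact hPsplit.map _
    · rw [← Polynomial.mul_divByMonic_eq_iff_isRoot.mpr hfα]
      refine (Polynomial.Splits.X_sub_C α).mul (Polynomial.Splits.of_natDegree_le_one ?_)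
      rw [Polynomial.natDegree_divByMonic _ (Polynomial.monic_X_sub_C α), Polynomial.natDegree_map,
        hf2, Polynomial.natDegree_X_sub_C]
  -- `E` is generated over `K` by the roots `θ` and `α`
  have hPf0 : P * f ≠ 0 := mul_ne_zero (minpoly.ne_zero hθint) hf.ne_zero
  have hθroot : algebraMap L E θ ∈ (P * f).rootSet E := by
    rw [Polynomial.mem_rootSet]
    refine ⟨hPf0, ?_⟩
    rw [map_mul, Polynomial.aeval_algebraMap_apply, hP, minpoly.aeval, map_zero, zero_mul]
  have hαroot : α ∈ (P * f).rootSet E := by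
    rw [Polynomial.mem_rootSet]
    refine ⟨hPf0, ?_⟩
    rw [map_mul]
    have : Polynomial.aeval α f = 0 := by
      have h := hfα
      rwa [Polynomial.IsRoot, Polynomial.eval_map, ← Polynomial.aeval_def] at h
    rw [this, mul_zero]
  have hadj : Algebra.adjoin K ((P * f).rootSet E) = ⊤ := by
    refine eq_top_iff.mpr fun y _ => ?_
    set A := Algebra.adjoin K ((P * f).rootSet E) with hA
    -- the image of `L` lies in `A`
    have hLA : ∀ x : L, algebraMap L E x ∈ A := by
      have hθtop : Algebra.adjoin K {θ} = ⊤ := by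
        rw [← IntermediateField.adjoin_simple_toSubalgebra_of_isAlgebraic (Algebra.IsAlgebraic.isAlgebraic θ), hθ]
        rfl
      intro x
      have hx : x ∈ Algebra.adjoin K {θ} := by rw [hθtop]; exact Algebra.mem_top
      have hmap : (Algebra.adjoin K {θ}).map (IsScalarTower.toAlgHom K L E) ≤ A := by
        rw [AlgHom.map_adjoin, Set.image_singleton]
        exact Algebra.adjoin_mono (Set.singleton_subset_iff.mpr hθroot)
      exact hmap ⟨x, hx, rfl⟩
    have hαA : α ∈ A := Algebra.subset_adjoin hαroot
    obtain ⟨a, b, rfl⟩ := AdjoinRoot.exists_eq_add_mul_root (hf.map (algebraMap K L))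
      (by rw [Polynomial.natDegree_map, hf2]) y
    exact A.add_mem (hLA a) (A.mul_mem (hLA b) hαA)
  haveI : Polynomial.IsSplittingField K E (P * f) := ⟨hsplits, hadj⟩
  exact IsGalois.of_separable_splitting_field hsepPf

end Galois

/-! ### The subfield `K_f = K(α)` and restriction `Gal(L_f/K_f) ≃ Gal(L/K)` -/

section Restrict

variable (K L : Type*) [Field K] [Field L] [Algebra K L] (f : K[X])
  [FiniteDimensional K L] [IsGalois K L]

omit [FiniteDimensional K L] [IsGalois K L] in
/-- `[K(α) : K] = 2` inside `L_f`. [folklore] -/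
theorem finrank_adjoin_root (hf : f.Monic) (hf2 : f.natDegree = 2)
    [Fact (Irreducible (f.map (algebraMap K L)))] :
    Module.finrank K (IntermediateField.adjoin K
      {AdjoinRoot.root (f.map (algebraMap K L))}) = 2 := by
  rw [IntermediateField.adjoin.finrank, minpoly_root_eq K L f hf, hf2]
  exact (minpoly_root_eq K L f hf ▸ hf.ne_zero) |> fun h => by
    by_contra hni
    exact h (minpoly.eq_zero hni)

/-- `[L_f : K(α)] = [L : K]`. [folklore] -/
theorem finrank_adjoinRoot_eq (hf : f.Monic) (hf2 : f.natDegree = 2)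
    [Fact (Irreducible (f.map (algebraMap K L)))] :
    Module.finrank (IntermediateField.adjoin K {AdjoinRoot.root (f.map (algebraMap K L))})
      (AdjoinRoot (f.map (algebraMap K L))) = Module.finrank K L := by
  set E := AdjoinRoot (f.map (algebraMap K L))
  set Kf := IntermediateField.adjoin K {AdjoinRoot.root (f.map (algebraMap K L))}
  haveI : FiniteDimensional K E := finiteDimensional_adjoinRoot_map K L f hf
  have h1 := Module.finrank_mul_finrank K Kf E
  have h2 := Module.finrank_mul_finrank K L E
  rw [finrank_adjoin_root K L f hf hf2] at h1
  rw [finrank_adjoinRoot_map K L f hf, hf2] at h2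
  linarith

/-- **Restriction `Gal(L_f/K(α)) → Gal(L/K)`** (restrict scalars to `K`, then to the normal
subextension `L`). [folklore] -/
def restrictQuadratic [Fact (Irreducible (f.map (algebraMap K L)))] :
    (AdjoinRoot (f.map (algebraMap K L)) ≃ₐ[IntermediateField.adjoin K
        {AdjoinRoot.root (f.map (algebraMap K L))}] AdjoinRoot (f.map (algebraMap K L))) →*
      (L ≃ₐ[K] L) :=
  (AlgEquiv.restrictNormalHom L).comp (AlgEquiv.restrictScalarsHom K)

omit [FiniteDimensional K L] in
/-- Compatibility of `restrictQuadratic` with `L ⊆ L_f`. [folklore] -/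
theorem algebraMap_restrictQuadratic [Fact (Irreducible (f.map (algebraMap K L)))]
    (σ : AdjoinRoot (f.map (algebraMap K L)) ≃ₐ[IntermediateField.adjoin K
        {AdjoinRoot.root (f.map (algebraMap K L))}] AdjoinRoot (f.map (algebraMap K L)))
    (x : L) :
    algebraMap L (AdjoinRoot (f.map (algebraMap K L))) (restrictQuadratic K L f σ x) =
      σ (algebraMap L (AdjoinRoot (f.map (algebraMap K L))) x) :=
  AlgEquiv.restrictNormal_commutes (AlgEquiv.restrictScalars K σ) L x

set_option maxHeartbeats 800000 in
/-- **`restrictQuadratic` is a bijection `Gal(L_f/K(α)) ≃ Gal(L/K)`**: injective because `L_f` is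
generated by `L` and `α ∈ K(α)`, bijective by `|Gal(L_f/K(α))| = [L_f : K(α)] = [L : K] = |Gal(L/K)|`.
Ref: Bourbaki, *Algèbre* V §10 no. 8 (translation theorem). [folklore] -/
theorem restrictQuadratic_bijective (hf : f.Monic) (hf2 : f.natDegree = 2) (hsep : f.Separable)
    [hirr : Fact (Irreducible (f.map (algebraMap K L)))] :
    Function.Bijective (restrictQuadratic K L f) := by
  classical
  set fL := f.map (algebraMap K L) with hfL
  set E := AdjoinRoot fL
  set α : E := AdjoinRoot.root fL with hα
  set Kf := IntermediateField.adjoin K {α} with hKf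
  haveI : IsGalois K E := isGalois_adjoinRoot_map K L f hf hf2 hsep
  haveI : FiniteDimensional K E := finiteDimensional_adjoinRoot_map K L f hf
  haveI : IsGalois Kf E := IsGalois.tower_top_of_isGalois K Kf E
  -- injectivity
  have hinj : Function.Injective (restrictQuadratic K L f) := by
    intro σ τ h
    rw [← inv_mul_eq_one]
    set ψ := σ⁻¹ * τ with hψ
    have hψ1 : restrictQuadratic K L f ψ = 1 := by rw [hψ, map_mul, map_inv, h, inv_mul_cancel]
    have hfixL : ∀ x : L, ψ (algebraMap L E x) = algebraMap L E x := fun x => by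
      rw [← algebraMap_restrictQuadratic K L f ψ x, hψ1, AlgEquiv.one_apply]
    have hfixα : ψ α = α := by
      have := ψ.commutes ⟨α, IntermediateField.mem_adjoin_simple_self K α⟩
      exact this
    let ψL : E →ₐ[L] E :=
      { ψ.toRingEquiv.toRingHom with commutes' := hfixL }
    have hext : ψL = AlgHom.id L E := AdjoinRoot.algHom_ext (by
      change ψ α = α
      exact hfixα)
    exact AlgEquiv.ext fun y => by
      have := congrArg (fun g : E →ₐ[L] E => g y) hext
      exact this
  refine (Nat.bijective_iff_injective_and_card _).mpr ⟨hinj, ?_⟩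
  rw [IsGalois.card_aut_eq_finrank, IsGalois.card_aut_eq_finrank]
  exact finrank_adjoinRoot_eq K L f hf hf2

/-- `Gal(L_f/K(α))` is cyclic when `Gal(L/K)` is. [folklore] -/
theorem isCyclic_of_restrictQuadratic (hf : f.Monic) (hf2 : f.natDegree = 2) (hsep : f.Separable)
    [Fact (Irreducible (f.map (algebraMap K L)))] [IsCyclic (L ≃ₐ[K] L)] :
    IsCyclic (AdjoinRoot (f.map (algebraMap K L)) ≃ₐ[IntermediateField.adjoin K
        {AdjoinRoot.root (f.map (algebraMap K L))}] AdjoinRoot (f.map (algebraMap K L))) :=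
  isCyclic_of_surjective (MulEquiv.ofBijective _ (restrictQuadratic_bijective K L f hf hf2 hsep)).symm
    (MulEquiv.surjective _)

end Restrict

/-! ### Coordinates `x = a + b α` in `L_f` for the quadratic `f = X² - tX + n`, and integrality -/

section Coords

variable {R : Type*} (K L : Type*) [CommRing R] [Field K] [Field L] [Algebra R K] [Algebra R L]
  [Algebra K L] [IsScalarTower R K L] (t n : R)

/-- The quadratic `X² - t X + n`. [folklore] -/
def quadPoly : R[X] := X ^ 2 - C t * X + C n

omit K L [Field K] [Field L] [Algebra R K] [Algebra R L] [Algebra K L] [IsScalarTower R K L] in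
/-- `quadPoly` under a ring map. [folklore] -/
theorem quadPoly_map {R' : Type*} [CommRing R'] (φ : R →+* R') :
    (quadPoly t n).map φ = quadPoly (φ t) (φ n) := by
  simp [quadPoly, Polynomial.map_sub, Polynomial.map_add, Polynomial.map_mul, Polynomial.map_pow]

omit K L [Field K] [Field L] [Algebra R K] [Algebra R L] [Algebra K L] [IsScalarTower R K L] in
/-- `quadPoly` as `C 1 X² + C (-t) X + C n`. [folklore] -/
theorem quadPoly_eq : quadPoly t n = C 1 * X ^ 2 + C (-t) * X + C n := by
  simp [quadPoly, sub_eq_add_neg]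

omit K L [Field K] [Field L] [Algebra R K] [Algebra R L] [Algebra K L] [IsScalarTower R K L] in
/-- `quadPoly` has degree `2` (over a nontrivial ring). [folklore] -/
theorem natDegree_quadPoly [Nontrivial R] : (quadPoly t n).natDegree = 2 := by
  rw [quadPoly_eq]; exact Polynomial.natDegree_quadratic one_ne_zero

omit K L [Field K] [Field L] [Algebra R K] [Algebra R L] [Algebra K L] [IsScalarTower R K L] in
/-- `quadPoly` is monic (over a nontrivial ring). [folklore] -/
theorem monic_quadPoly [Nontrivial R] : (quadPoly t n).Monic := by
  rw [Polynomial.Monic, quadPoly_eq, Polynomial.leadingCoeff_quadratic one_ne_zero]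

variable [Fact (Irreducible (((quadPoly t n).map (algebraMap R K)).map (algebraMap K L)))]

local notation "fKL" => Polynomial.map (algebraMap K L) (Polynomial.map (algebraMap R K) (quadPoly t n))

omit [Fact (Irreducible (((quadPoly t n).map (algebraMap R K)).map (algebraMap K L)))] in
/-- `f_{K,L} = X² - t X + n` over `L`. [folklore] -/
theorem map_map_quadPoly : fKL = quadPoly (algebraMap R L t) (algebraMap R L n) := by
  rw [quadPoly_map, quadPoly_map, ← IsScalarTower.algebraMap_apply, ← IsScalarTower.algebraMap_apply]

omit [Fact (Irreducible (((quadPoly t n).map (algebraMap R K)).map (algebraMap K L)))] in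
/-- `f_{K,L}` is monic of degree `2`. [folklore] -/
theorem monic_map_map_quadPoly : (fKL).Monic ∧ (fKL).natDegree = 2 := by
  rw [map_map_quadPoly]; exact ⟨monic_quadPoly _ _, natDegree_quadPoly _ _⟩

/-- `algebraMap R L_f` factors through `K` and `L`. [folklore] -/
theorem algebraMap_adjoinRoot_eq : algebraMap R (AdjoinRoot fKL) =
    ((AdjoinRoot.of fKL).comp (algebraMap K L)).comp (algebraMap R K) := by
  rw [IsScalarTower.algebraMap_eq R K (AdjoinRoot fKL), IsScalarTower.algebraMap_eq K L (AdjoinRoot fKL),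
    AdjoinRoot.algebraMap_eq]

/-- The defining relation `α² = t α - n` in `L_f`. [folklore] -/
theorem root_sq : AdjoinRoot.root fKL ^ 2 =
    algebraMap R (AdjoinRoot fKL) t * AdjoinRoot.root fKL - algebraMap R (AdjoinRoot fKL) n := by
  have h := AdjoinRoot.eval₂_root fKL
  rw [Polynomial.eval₂_map, Polynomial.eval₂_map] at h
  set φ := ((AdjoinRoot.of fKL).comp (algebraMap K L)).comp (algebraMap R K) with hφ
  set α := AdjoinRoot.root fKL with hα
  have h2 : Polynomial.eval₂ φ α (quadPoly t n) = α ^ 2 - φ t * α + φ n := by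
    show Polynomial.eval₂ φ α (X ^ 2 - C t * X + C n) = _
    rw [Polynomial.eval₂_add, Polynomial.eval₂_sub, Polynomial.eval₂_mul, Polynomial.eval₂_X_pow,
      Polynomial.eval₂_C, Polynomial.eval₂_C, Polynomial.eval₂_X]
  rw [h2] at h
  rw [algebraMap_adjoinRoot_eq, ← hφ]
  linear_combination h

/-- `α` is integral over `R`. [folklore] -/
theorem isIntegral_root : IsIntegral R (AdjoinRoot.root fKL) := by
  haveI : Nontrivial R := (algebraMap R K).domain_nontrivial
  refine ⟨quadPoly t n, monic_quadPoly t n, ?_⟩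
  have h := AdjoinRoot.eval₂_root fKL
  rw [Polynomial.eval₂_map, Polynomial.eval₂_map] at h
  rw [algebraMap_adjoinRoot_eq]
  exact h

/-- `f_{K,L}` has no root in `L`. [folklore] -/
theorem aeval_map_quadPoly_ne_zero (r : L) :
    Polynomial.aeval r ((quadPoly t n).map (algebraMap R K)) ≠ 0 := by
  have hirr : Irreducible fKL := Fact.out
  have hm := monic_map_map_quadPoly K L t n
  have hroots := (Polynomial.Monic.irreducible_iff_roots_eq_zero_of_degree_le_three hm.1
    (by rw [hm.2]) (by rw [hm.2]; norm_num)).mp hirr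
  intro h
  have hmem : r ∈ (fKL).roots := by
    rw [Polynomial.mem_roots hm.1.ne_zero, Polynomial.IsRoot, Polynomial.eval_map, ← Polynomial.aeval_def]
    exact h
  rw [hroots] at hmem
  exact Multiset.notMem_zero r hmem

/-- **Uniqueness of coordinates** `a + b α` (`a, b ∈ L`) in `L_f`. [folklore] -/
theorem coord_unique {a b a' b' : L}
    (h : algebraMap L (AdjoinRoot fKL) a + algebraMap L (AdjoinRoot fKL) b * AdjoinRoot.root fKL =
      algebraMap L (AdjoinRoot fKL) a' + algebraMap L (AdjoinRoot fKL) b' * AdjoinRoot.root fKL) :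
    a = a' ∧ b = b' := by
  set α := AdjoinRoot.root fKL with hα
  have hinj : Function.Injective (algebraMap L (AdjoinRoot fKL)) := (algebraMap L (AdjoinRoot fKL)).injective
  by_cases hb : b = b'
  · subst hb
    refine ⟨hinj ?_, rfl⟩
    exact add_right_cancel h
  · exfalso
    -- `α = (a' - a)/(b - b') ∈ L`: a root of `f` in `L`
    have hbb : algebraMap L (AdjoinRoot fKL) (b - b') ≠ 0 := by
      rw [Ne, map_eq_zero_iff _ hinj, sub_eq_zero]; exact hb
    set r : L := (a' - a) / (b - b') with hr
    have hαr : α = algebraMap L (AdjoinRoot fKL) r := by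
      have h1 : algebraMap L (AdjoinRoot fKL) (b - b') * α = algebraMap L (AdjoinRoot fKL) (a' - a) := by
        rw [map_sub, map_sub]; linear_combination h
      rw [hr, map_div₀, eq_div_iff hbb, mul_comm, ← h1]
    apply aeval_map_quadPoly_ne_zero K L t n r
    have h2 : Polynomial.aeval α ((quadPoly t n).map (algebraMap R K)) = 0 := by
      have h0 := AdjoinRoot.eval₂_root fKL
      rw [Polynomial.eval₂_map] at h0
      rw [Polynomial.aeval_def, IsScalarTower.algebraMap_eq K L (AdjoinRoot fKL), AdjoinRoot.algebraMap_eq]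
      exact h0
    rw [hαr, Polynomial.aeval_algebraMap_apply] at h2
    exact hinj (by rw [h2, map_zero])

/-- Existence of coordinates. [folklore] -/
theorem exists_coord (x : AdjoinRoot fKL) : ∃ ab : L × L,
    x = algebraMap L (AdjoinRoot fKL) ab.1 + algebraMap L (AdjoinRoot fKL) ab.2 * AdjoinRoot.root fKL := by
  have hm := monic_map_map_quadPoly K L t n
  obtain ⟨a, b, h⟩ := AdjoinRoot.exists_eq_add_mul_root hm.1 hm.2 x
  exact ⟨(a, b), h⟩

/-- **The coordinates** `(a, b)` of `x = a + b α ∈ L_f`. [folklore] -/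
def coord (x : AdjoinRoot fKL) : L × L := Classical.choose (exists_coord K L t n x)

/-- `x = a + b α` for `(a, b) = coord x`. [folklore] -/
theorem coord_spec (x : AdjoinRoot fKL) :
    x = algebraMap L (AdjoinRoot fKL) (coord K L t n x).1 +
      algebraMap L (AdjoinRoot fKL) (coord K L t n x).2 * AdjoinRoot.root fKL :=
  Classical.choose_spec (exists_coord K L t n x)

/-- Characterisation of `coord`. [folklore] -/
theorem coord_eq_iff (x : AdjoinRoot fKL) (a b : L) : coord K L t n x = (a, b) ↔
    x = algebraMap L (AdjoinRoot fKL) a + algebraMap L (AdjoinRoot fKL) b * AdjoinRoot.root fKL := by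
  constructor
  · intro h; rw [coord_spec K L t n x, h]
  · intro h
    have h' := (coord_spec K L t n x).symm.trans h
    obtain ⟨h1, h2⟩ := coord_unique K L t n h'
    exact Prod.ext h1 h2

/-- Coordinates of `a ∈ L`. [folklore] -/
theorem coord_algebraMap (a : L) : coord K L t n (algebraMap L (AdjoinRoot fKL) a) = (a, 0) := by
  rw [coord_eq_iff, map_zero, zero_mul, add_zero]

/-- Coordinates of `α`. [folklore] -/
theorem coord_root : coord K L t n (AdjoinRoot.root fKL) = (0, 1) := by
  rw [coord_eq_iff, map_zero, map_one, zero_add, one_mul]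

/-- Coordinates of a sum. [folklore] -/
theorem coord_add (x y : AdjoinRoot fKL) :
    coord K L t n (x + y) = ((coord K L t n x).1 + (coord K L t n y).1,
      (coord K L t n x).2 + (coord K L t n y).2) := by
  rw [coord_eq_iff]
  conv_lhs => rw [coord_spec K L t n x, coord_spec K L t n y]
  rw [map_add, map_add]; ring

/-- Coordinates of a product: `(a + bα)(a' + b'α) = (aa' - n bb') + (ab' + a'b + t bb') α`.
[folklore] -/
theorem coord_mul (x y : AdjoinRoot fKL) :
    coord K L t n (x * y) =
      ((coord K L t n x).1 * (coord K L t n y).1 -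
          algebraMap R L n * ((coord K L t n x).2 * (coord K L t n y).2),
        (coord K L t n x).1 * (coord K L t n y).2 + (coord K L t n y).1 * (coord K L t n x).2 +
          algebraMap R L t * ((coord K L t n x).2 * (coord K L t n y).2)) := by
  rw [coord_eq_iff]
  conv_lhs => rw [coord_spec K L t n x, coord_spec K L t n y]
  have hsq := root_sq K L t n
  rw [IsScalarTower.algebraMap_apply R L (AdjoinRoot fKL) t,
    IsScalarTower.algebraMap_apply R L (AdjoinRoot fKL) n] at hsq
  simp only [map_add, map_sub, map_mul]
  linear_combination (algebraMap L (AdjoinRoot fKL) (coord K L t n x).2 *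
    algebraMap L (AdjoinRoot fKL) (coord K L t n y).2) * hsq

/-- **The conjugation** `α ↦ t - α` of `L_f` over `L`. [folklore] -/
def conjQuad : AdjoinRoot fKL →+* AdjoinRoot fKL :=
  AdjoinRoot.lift (algebraMap L (AdjoinRoot fKL))
    (algebraMap R (AdjoinRoot fKL) t - AdjoinRoot.root fKL) (by
      have hsq := root_sq K L t n
      rw [Polynomial.eval₂_map, Polynomial.eval₂_map, AdjoinRoot.algebraMap_eq, ← algebraMap_adjoinRoot_eq]
      set ψ := algebraMap R (AdjoinRoot fKL) with hψ
      set β := ψ t - AdjoinRoot.root fKL with hβ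
      show Polynomial.eval₂ ψ β (X ^ 2 - C t * X + C n) = 0
      rw [Polynomial.eval₂_add, Polynomial.eval₂_sub, Polynomial.eval₂_mul, Polynomial.eval₂_X_pow,
        Polynomial.eval₂_C, Polynomial.eval₂_C, Polynomial.eval₂_X, hβ]
      linear_combination hsq)

/-- `conjQuad` fixes `L`. [folklore] -/
theorem conjQuad_algebraMap (a : L) :
    conjQuad K L t n (algebraMap L (AdjoinRoot fKL) a) = algebraMap L (AdjoinRoot fKL) a := by
  have h : algebraMap L (AdjoinRoot fKL) a = AdjoinRoot.mk fKL (C a) := by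
    rw [AdjoinRoot.mk_C, AdjoinRoot.algebraMap_eq]
  rw [h]
  show AdjoinRoot.lift _ _ _ (AdjoinRoot.mk fKL (C a)) = _
  rw [AdjoinRoot.lift_mk, Polynomial.eval₂_C]
  exact h

/-- `conjQuad α = t - α`. [folklore] -/
theorem conjQuad_root :
    conjQuad K L t n (AdjoinRoot.root fKL) = algebraMap R (AdjoinRoot fKL) t - AdjoinRoot.root fKL := by
  rw [conjQuad]; exact AdjoinRoot.lift_root _

/-- `conjQuad` as an `R`-algebra map. [folklore] -/
def conjQuadAlgHom : AdjoinRoot fKL →ₐ[R] AdjoinRoot fKL :=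
  { conjQuad K L t n with
    commutes' := fun r => by
      simp only [RingHom.toMonoidHom_eq_coe, OneHom.toFun_eq_coe, MonoidHom.toOneHom_coe,
        MonoidHom.coe_coe]
      rw [IsScalarTower.algebraMap_apply R L (AdjoinRoot fKL), conjQuad_algebraMap] }

/-- **Integrality of the `d`-scaled coordinates**: for `x ∈ L_f` integral over `R` with
`x = a + b α`, `d a` and `d b` are integral over `R`, `d = t² - 4n` the discriminant
(`(x - x̄)(2α - t) = b d`, `x̄` the conjugate).  Ref: standard (`d 𝒪_{L_f} ⊆ 𝒪_L[α]`). [folklore] -/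
theorem isIntegral_coord (x : AdjoinRoot fKL) (hx : IsIntegral R x) :
    IsIntegral R ((coord K L t n x).1 * algebraMap R L (t ^ 2 - 4 * n)) ∧
      IsIntegral R ((coord K L t n x).2 * algebraMap R L (t ^ 2 - 4 * n)) := by
  have hinj : Function.Injective (algebraMap L (AdjoinRoot fKL)) := (algebraMap L (AdjoinRoot fKL)).injective
  set a := (coord K L t n x).1 with ha
  set b := (coord K L t n x).2 with hb
  have hxab : x = algebraMap L (AdjoinRoot fKL) a + algebraMap L (AdjoinRoot fKL) b * AdjoinRoot.root fKL :=
    coord_spec K L t n x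
  have hαint : IsIntegral R (AdjoinRoot.root fKL) := isIntegral_root K L t n
  have htint : IsIntegral R (algebraMap R (AdjoinRoot fKL) t) := isIntegral_algebraMap
  have hτx : IsIntegral R (conjQuad K L t n x) := hx.map (conjQuadAlgHom K L t n)
  have hτ : conjQuad K L t n x = algebraMap L (AdjoinRoot fKL) a +
      algebraMap L (AdjoinRoot fKL) b * (algebraMap R (AdjoinRoot fKL) t - AdjoinRoot.root fKL) := by
    conv_lhs => rw [hxab]
    rw [map_add, map_mul, conjQuad_algebraMap, conjQuad_algebraMap, conjQuad_root]
  have hsq := root_sq K L t n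
  -- `(x - x̄)(2α - t) = b d`
  have hbd : algebraMap L (AdjoinRoot fKL) (b * algebraMap R L (t ^ 2 - 4 * n)) =
      (x - conjQuad K L t n x) *
        (AdjoinRoot.root fKL + AdjoinRoot.root fKL - algebraMap R (AdjoinRoot fKL) t) := by
    rw [map_mul, ← IsScalarTower.algebraMap_apply, map_sub, map_mul, map_pow, hτ, hxab]
    simp only [map_ofNat]
    linear_combination (-4 * algebraMap L (AdjoinRoot fKL) b) * hsq
  have hbint : IsIntegral R (b * algebraMap R L (t ^ 2 - 4 * n)) := by
    rw [← isIntegral_algebraMap_iff hinj, hbd]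
    exact (hx.sub hτx).mul ((hαint.add hαint).sub htint)
  have had : algebraMap L (AdjoinRoot fKL) (a * algebraMap R L (t ^ 2 - 4 * n)) =
      algebraMap R (AdjoinRoot fKL) (t ^ 2 - 4 * n) * x -
        algebraMap L (AdjoinRoot fKL) (b * algebraMap R L (t ^ 2 - 4 * n)) * AdjoinRoot.root fKL := by
    rw [map_mul, map_mul, ← IsScalarTower.algebraMap_apply, hxab]
    ring
  have haint : IsIntegral R (a * algebraMap R L (t ^ 2 - 4 * n)) := by
    rw [← isIntegral_algebraMap_iff hinj, had]
    refine (isIntegral_algebraMap.mul hx).sub (IsIntegral.mul ?_ hαint)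
    exact (isIntegral_algebraMap_iff hinj).mpr hbint
  exact ⟨haint, hbint⟩

end Coords


end Literature.NumberTheory.GaloisRepresentations

end
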